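import Summits.AnomalousDissipation.AnomalousDissipation.Theorems.BaireTransferRobustLoudUpgradeStubMalkinBorderedA
import Summits.AnomalousDissipation.AnomalousDissipation.Theorems.BaireTransferRobustLoudUpgradeStubSteadyWindow

/-!
# Stub `stub_malkinBordered` of the line `malkin-cone-group-orbits` (crux stmt-AnomalousDissipation-1144):
# `malkinSteady S a E ε ⊆ borderedSteady S a E ε`

Registered signature (proved here, textually):
`theorem stub_malkinBordered : ∀ (S : Finset (Fin 3 → ℤ)) (a E ε : ℝ), malkinSteady S a E ε ⊆ borderedSteady S a E ε`.

Part A (`…StubMalkinBorderedA.lean`) proved the bordered steady implicit function theorem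
`exists_bordered_correction` at a Malkin-visible Goldstone steady state (Vanderbauwhede 1982 Thm. 8.2.11 / §8.5;
Dancer 1984): `σ`, `ℓ = Dσ(c)` with `σ c = 0`, `ℓ d = 1`, and for every `δ > 0` a ball around `c` on which `σ` is
continuous and every corrected force `f_{c' − σ(c') d}` carries a mean-zero classical steady state of `NS_ν`
within squared `H¹`-distance `δ` of `u₀`.  Here the STRICT budgets of `u₀` (`∫‖u₀‖² < E`, `ν‖∇u₀‖₂² > ε`) are
turned into a Peter–Paul slack absorbing such a perturbation (the window lemmas `integral_norm_sq_le`,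
`gradNormSq_le`, `meanEnergy_const`, `meanDissipation_const` of `…StubSteadyWindow.lean`), which assembles the
class `borderedSteady` of the vocabulary module (§6, reshape v3).  Pure proof file (no definitions).
-/

-- `Summit.<Summit>.<Problem>` is the tree's mandated summit-side namespace (CONVENTIONS §2); for this
-- single-conjunct summit the two coincide, so the duplicate is deliberate.
set_option linter.dupNamespace false

noncomputable section

open scoped BigOperators Topology
open Filter Set Function TopologicalSpace MeasureTheory

namespace Summit.AnomalousDissipation.AnomalousDissipation.Theorems.RobustLoudUpgrade.MalkinBordered

open Literature.Analysis.FunctionSpaces Literature.Analysis.FunctionSpaces.Torus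
open Literature.Analysis.FluidPDE
open Summit.AnomalousDissipation.AnomalousDissipation.Theses.BaireTransfer
open Summit.AnomalousDissipation.AnomalousDissipation.Theorems.RobustLoudUpgrade.SteadyWindow

/-! ## Budgets inside the strict slack, and the registered stub -/

section Assembly

variable {S : Finset (Fin 3 → ℤ)} {a E ε : ℝ}

/-- **From the bordered correction to the class `borderedSteady`**: the strict budgets of `u₀` leave a
Peter–Paul slack absorbing an `H¹`-perturbation of squared size `δ`, so on the ball delivered by
`exists_bordered_correction` for that `δ` the corrected steady states have budgets `≤ E`, `≥ ε`
(pattern of `stub_steadyWindow`). [folklore] -/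
theorem mem_borderedSteady_of_malkin {c : Coeff S} (hc : c ∈ malkinSteady S a E ε) : c ∈ borderedSteady S a E ε := by
  obtain ⟨ν, hν, hνa, u₀, p₀, hst, h0, hE, hε, dir, -, hcinv, hker, d, hd, hvis⟩ := hc
  obtain ⟨σ, ℓ, hσc, hσ, hℓ, hwin⟩ := exists_bordered_correction hν hst h0 hker hvis
  have hsm₀ : IsSmooth u₀ := hst.smooth_velocity.isSmooth_slice (Set.mem_univ (0 : ℝ))
  -- the budgets of `u₀`, as integrals over `T³`
  set A₀ : ℝ := ∫ x, ‖u₀ x‖ ^ 2 with hA₀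
  set G₀ : ℝ := gradNormSq u₀ with hG₀
  have hA : A₀ < E := by rwa [meanEnergy_const] at hE
  have hG : ε < ν * G₀ := by rwa [meanDissipation_const ν hsm₀] at hε
  -- slack: `η > 0` with `(1+η)A₀ < E`, `(1+η)ε < νG₀`
  obtain ⟨η, ⟨hηE, hηε⟩, hη0⟩ :
      ∃ η : ℝ, ((1 + η) * A₀ < E ∧ (1 + η) * ε < ν * G₀) ∧ 0 < η := by
    have h1 : ∀ᶠ η : ℝ in 𝓝 0, (1 + η) * A₀ < E :=
      Filter.Tendsto.eventually_lt_const (v := (1 + 0) * A₀) (by simpa using hA)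
        (((continuous_const.add continuous_id).mul continuous_const).tendsto' _ _ rfl)
    have h2 : ∀ᶠ η : ℝ in 𝓝 0, (1 + η) * ε < ν * G₀ :=
      Filter.Tendsto.eventually_lt_const (v := (1 + 0) * ε) (by simpa using hG)
        (((continuous_const.add continuous_id).mul continuous_const).tendsto' _ _ rfl)
    exact (((h1.and h2).filter_mono nhdsWithin_le_nhds).and
      (self_mem_nhdsWithin : Set.Ioi (0 : ℝ) ∈ 𝓝[>] (0 : ℝ))).exists
  -- then `δ > 0` absorbing the `H¹`-perturbation
  obtain ⟨δ, ⟨hδE, hδε⟩, hδ0⟩ : ∃ δ : ℝ, ((1 + η) * A₀ + (1 + η⁻¹) * δ < E ∧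
      (1 + η) * ε + ν * ((1 + η⁻¹) * δ) < ν * G₀) ∧ 0 < δ := by
    have h1 : ∀ᶠ δ : ℝ in 𝓝 0, (1 + η) * A₀ + (1 + η⁻¹) * δ < E :=
      Filter.Tendsto.eventually_lt_const (v := (1 + η) * A₀ + (1 + η⁻¹) * 0) (by simpa using hηE)
        ((continuous_const.add (continuous_const.mul continuous_id)).tendsto' _ _ rfl)
    have h2 : ∀ᶠ δ : ℝ in 𝓝 0, (1 + η) * ε + ν * ((1 + η⁻¹) * δ) < ν * G₀ :=
      Filter.Tendsto.eventually_lt_const (v := (1 + η) * ε + ν * ((1 + η⁻¹) * 0))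
        (by simpa using hηε)
        ((continuous_const.add
          (continuous_const.mul (continuous_const.mul continuous_id))).tendsto' _ _ rfl)
    exact (((h1.and h2).filter_mono nhdsWithin_le_nhds).and
      (self_mem_nhdsWithin : Set.Ioi (0 : ℝ) ∈ 𝓝[>] (0 : ℝ))).exists
  -- the bordered window for this `δ`
  obtain ⟨r, hr, hcont, hball⟩ := hwin δ hδ0
  refine ⟨ν, hν, hνa, dir, d, ℓ, σ, r, hcinv, hd, hℓ, hσc, hσ, hr, hcont, fun c' hc' => ?_⟩
  obtain ⟨u', p', hst', -, hdist⟩ := hball c' hc'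
  have hsm' : IsSmooth u' := hst'.smooth_velocity.isSmooth_slice (Set.mem_univ (0 : ℝ))
  -- split the squared `H¹` distance into its two nonnegative parts
  have hL2 : 0 ≤ ∫ x, ‖u' x - u₀ x‖ ^ 2 := integral_nonneg fun _ => sq_nonneg _
  have hH1 : 0 ≤ gradNormSq (fun x => u' x - u₀ x) := gradNormSq_nonneg _
  have hdist' : (∫ x, ‖u' x - u₀ x‖ ^ 2) + gradNormSq (fun x => u' x - u₀ x) < δ := hdist
  have hdL : ∫ x, ‖u' x - u₀ x‖ ^ 2 ≤ δ := by linarith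
  have hdG : gradNormSq (fun x => u' x - u₀ x) ≤ δ := by linarith
  have hη1 : 0 ≤ 1 + η⁻¹ := by positivity
  refine ⟨u', p', hst', ?_, ?_⟩
  · -- energy budget `∫‖u'‖² ≤ E`
    rw [meanEnergy_const]
    have h := integral_norm_sq_le hsm₀.continuous hsm'.continuous hη0
    have : (1 + η⁻¹) * ∫ x, ‖u' x - u₀ x‖ ^ 2 ≤ (1 + η⁻¹) * δ :=
      mul_le_mul_of_nonneg_left hdL hη1
    linarith
  · -- dissipation budget `ε ≤ ν‖∇u'‖₂²`
    rw [meanDissipation_const ν hsm']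
    have h := gradNormSq_le hsm₀ hsm' hη0
    have h1 : (1 + η⁻¹) * gradNormSq (fun x => u' x - u₀ x) ≤ (1 + η⁻¹) * δ :=
      mul_le_mul_of_nonneg_left hdG hη1
    have h2 : ν * G₀ ≤ ν * ((1 + η) * gradNormSq u' + (1 + η⁻¹) * δ) :=
      mul_le_mul_of_nonneg_left (by linarith) hν.le
    have h3 : (1 + η) * ε < (1 + η) * (ν * gradNormSq u') := by nlinarith
    exact (lt_of_mul_lt_mul_left h3 (by linarith)).le

end Assembly

/-- **Stub `stub_malkinBordered` of the line `malkin-cone-group-orbits`**: Malkin-visible Goldstone steady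
witnesses are bordered-persistent (`malkinSteady ⊆ borderedSteady`), by the bordered steady implicit function
theorem `exists_bordered_correction` and the strict-slack window `mem_borderedSteady_of_malkin`. [folklore] -/
theorem stub_malkinBordered : ∀ (S : Finset (Fin 3 → ℤ)) (a E ε : ℝ), malkinSteady S a E ε ⊆ borderedSteady S a E ε :=
  fun _ _ _ _ _ hc => mem_borderedSteady_of_malkin hc

end Summit.AnomalousDissipation.AnomalousDissipation.Theorems.RobustLoudUpgrade.MalkinBordered

end
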